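import Summits.CriticalPhenomena.PercolationContinuityZ3.Theorems.PercNearOneGluingNoHeavyLowerTailQ44bPackingsAllN
import Summits.CriticalPhenomena.PercolationContinuityZ3.Theorems.PercNearOneGluingNoHeavyLowerTailQ44bPencilReduction

/-!
# `Q44b.row` in four-point cell form, and `Q44b ∀n` from the nine-type fibre statement

Support file for crux `stmt-CriticalPhenomena-4575` (master-family programme, quadratic four-point row `Q44b`),
seat `prim-l12-p6` gen 10.  No named facts, no sorries, no new definitions.

* `Q44b.row_eq_cells`: the tree's row `Q44b.row w a b c y = P(AC)P(∅) − P(AΔ)P(X) − P(ab|c|y)P(C¬A) − P(a|bcy)P(X′)`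
  (`…Q44bPencilReduction`) equals `(cell 11 + cell 14)·cell 0 − Σ_{θ=1}^{9} cell(h θ)·cell(l θ)` (`FourPointAtoms.cell`,
  `TwoCopyMono.hIdx/lIdx`), i.e. it is the `kerS {1,…,9}` bilinear cell form of `…NineTypeKernels`.
* `Q44b.row_nonneg_of_goodKernel`: **if the full nine-type kernel is good** (`TwoCopyMono.GoodKernel (kerS (Icc 1 9))` — the
  fibre statement that bnk-1 g17's rule R7 / Conjecture R would give; its two clash-free halves are the theorems
  `goodKernel_kerS`), **then `0 ≤ Q44b.row w a b c y` for every finite weighted graph** (two-copy bridge `…TwoCopyMonotoneBridge`).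
  This pins the single remaining hypothesis of `Q44b ∀n` on this line; it is CONDITIONAL (the hypothesis is open).
-/

noncomputable section

namespace Summit.CriticalPhenomena.PercolationContinuityZ3.Theorems

open MeasureTheory Set Finset Literature.Probability.Percolation
open Literature.Probability.LatticeModels (prodBernoulli)
open Summit.CriticalPhenomena.PercolationContinuityZ3.Cruxes.AdditiveGluing.TieLine.ConnAtoms
open FourPointAtoms

namespace Q44b

variable {n : ℕ} (w : Sym2 (Fin n) → unitInterval) (a b c y : Fin n)

/-- `P(AC) = cell 11 + cell 14`. [this work] -/
theorem real_evAC : (prodBernoulli w).real (evAC a b c y) = cell w a b c y 11 + cell w a b c y 14 := by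
  rw [measureReal_eq_cellSum w a b c y (show HasPattern (quad a b c y) (evAC a b c y) _ from
    (oc a b c y 0 1 rfl rfl).inter (oc a b c y 2 3 rfl rfl))]
  simp (config := {decide := true}) only [ite_true, ite_false]; ring

/-- `P(∅) = cell 0`. [this work] -/
theorem real_evEmp : (prodBernoulli w).real (evEmp a b c y) = cell w a b c y 0 := by
  rw [measureReal_eq_cellSum w a b c y (show HasPattern (quad a b c y) (evEmp a b c y) _ from
    ((((((oc a b c y 0 1 rfl rfl).compl.inter (oc a b c y 0 2 rfl rfl).compl).inter (oc a b c y 0 3 rfl rfl).compl).inter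
      (oc a b c y 1 2 rfl rfl).compl).inter (oc a b c y 1 3 rfl rfl).compl).inter (oc a b c y 2 3 rfl rfl).compl))]
  simp (config := {decide := true}) only [ite_true, ite_false]; ring

/-- `P(AΔ) = cell 11 + cell 6`. [this work] -/
theorem real_evAD : (prodBernoulli w).real (evAD a b c y) = cell w a b c y 11 + cell w a b c y 6 := by
  rw [measureReal_eq_cellSum w a b c y (show HasPattern (quad a b c y) (evAD a b c y) _ from
    (((oc a b c y 0 1 rfl rfl).inter (oc a b c y 0 2 rfl rfl).compl).inter (oc a b c y 0 3 rfl rfl).compl))]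
  simp (config := {decide := true}) only [ite_true, ite_false]; ring

/-- `P(X) = cell 9 + cell 8`. [this work] -/
theorem real_evX : (prodBernoulli w).real (evX a b c y) = cell w a b c y 9 + cell w a b c y 8 := by
  rw [measureReal_eq_cellSum w a b c y (show HasPattern (quad a b c y) (evX a b c y) _ from
    ((oc a b c y 0 1 rfl rfl).compl.inter (((oc a b c y 0 2 rfl rfl).inter (oc a b c y 1 3 rfl rfl)).union
      ((oc a b c y 0 3 rfl rfl).inter (oc a b c y 1 2 rfl rfl)))))]
  simp (config := {decide := true}) only [ite_true, ite_false]; ring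

/-- `P(ab|c|y) = cell 6`. [this work] -/
theorem real_evAB : (prodBernoulli w).real (evAB a b c y) = cell w a b c y 6 := by
  rw [measureReal_eq_cellSum w a b c y (show HasPattern (quad a b c y) (evAB a b c y) _ from
    ((((oc a b c y 0 1 rfl rfl).inter (oc a b c y 0 2 rfl rfl).compl).inter (oc a b c y 0 3 rfl rfl).compl).inter
      (oc a b c y 2 3 rfl rfl).compl))]
  simp (config := {decide := true}) only [ite_true, ite_false]; ring

/-- `P(C¬A) = cell 1 + cell 10 + cell 7`. [this work] -/
theorem real_evCnA : (prodBernoulli w).real (evCnA a b c y) = cell w a b c y 1 + cell w a b c y 10 + cell w a b c y 7 := by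
  rw [measureReal_eq_cellSum w a b c y (show HasPattern (quad a b c y) (evCnA a b c y) _ from
    ((oc a b c y 2 3 rfl rfl).inter (oc a b c y 0 1 rfl rfl).compl))]
  simp (config := {decide := true}) only [ite_true, ite_false]; ring

/-- `P(a|bcy) = cell 7`. [this work] -/
theorem real_evPend : (prodBernoulli w).real (evPend a b c y) = cell w a b c y 7 := by
  rw [measureReal_eq_cellSum w a b c y (show HasPattern (quad a b c y) (evPend a b c y) _ from
    (((((oc a b c y 0 1 rfl rfl).compl.inter (oc a b c y 0 2 rfl rfl).compl).inter (oc a b c y 0 3 rfl rfl).compl).inter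
      (oc a b c y 1 2 rfl rfl)).inter (oc a b c y 1 3 rfl rfl)))]
  simp (config := {decide := true}) only [ite_true, ite_false]; ring

/-- `P(X′) = cell 5 + cell 4`. [this work] -/
theorem real_evXp : (prodBernoulli w).real (evXp a b c y) = cell w a b c y 5 + cell w a b c y 4 := by
  rw [measureReal_eq_cellSum w a b c y (show HasPattern (quad a b c y) (evXp a b c y) _ from
    ((oc a b c y 0 1 rfl rfl).compl.inter
      ((((oc a b c y 0 2 rfl rfl).inter (oc a b c y 0 3 rfl rfl).compl).inter (oc a b c y 1 3 rfl rfl).compl).union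
       (((oc a b c y 0 3 rfl rfl).inter (oc a b c y 0 2 rfl rfl).compl).inter (oc a b c y 1 2 rfl rfl).compl))))]
  simp (config := {decide := true}) only [ite_true, ite_false]; ring

/-- **`Q44b.row` in cell form**: `row = (cell 11 + cell 14)·cell 0 − Σ_{θ=1}^{9} cell(h θ)·cell(l θ)`. [this work] -/
theorem row_eq_cells :
    row w a b c y = (cell w a b c y 11 + cell w a b c y 14) * cell w a b c y 0 -
      ∑ θ ∈ (Finset.Icc 1 9 : Finset ℕ), cell w a b c y (TwoCopyMono.hIdx θ) * cell w a b c y (TwoCopyMono.lIdx θ) := by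
  have hsum : (∑ θ ∈ (Finset.Icc 1 9 : Finset ℕ), cell w a b c y (TwoCopyMono.hIdx θ) * cell w a b c y (TwoCopyMono.lIdx θ)) =
      (cell w a b c y 11 + cell w a b c y 6) * (cell w a b c y 9 + cell w a b c y 8) +
      cell w a b c y 6 * (cell w a b c y 1 + cell w a b c y 10 + cell w a b c y 7) +
      cell w a b c y 7 * (cell w a b c y 5 + cell w a b c y 4) := by
    have hI : (Finset.Icc 1 9 : Finset ℕ) = {1, 2, 3, 4, 5, 6, 7, 8, 9} := by decide
    rw [hI]
    rw [Finset.sum_insert (by decide), Finset.sum_insert (by decide), Finset.sum_insert (by decide), Finset.sum_insert (by decide),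
      Finset.sum_insert (by decide), Finset.sum_insert (by decide), Finset.sum_insert (by decide), Finset.sum_insert (by decide),
      Finset.sum_singleton]
    simp only [TwoCopyMono.hIdx, TwoCopyMono.lIdx]
    norm_num
    ring
  rw [hsum]
  unfold row bil
  rw [real_evAC, real_evEmp, real_evAD, real_evX, real_evAB, real_evCnA, real_evPend, real_evXp]
  ring

/-- **`Q44b ∀n` from the nine-type fibre statement (conditional).**  If the full nine-type kernel is good — the fibre statement
of the OTA programme with all nine types (`prim-bnk-1` g17 rule R7 / Conjecture R; its clash-free halves are theorems,
`TwoCopyMono.goodKernel_kerS`) — then `Q44b.row w a b c y ≥ 0` on every finite weighted graph. [this work] -/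
theorem row_nonneg_of_goodKernel (h : TwoCopyMono.GoodKernel (TwoCopyMono.kerS (Finset.Icc 1 9 : Finset ℕ))) :
    0 ≤ row w a b c y := by
  have hS : ∀ θ ∈ (Finset.Icc 1 9 : Finset ℕ), 1 ≤ θ ∧ θ ≤ 9 := fun θ hθ => Finset.mem_Icc.1 hθ
  have h1 := TwoCopyMono.sum_kernel_cell_nonneg h w a b c y
  rw [TwoCopyMono.sum_kerS_cell _ hS] at h1
  rw [row_eq_cells]
  exact h1

end Q44b

end Summit.CriticalPhenomena.PercolationContinuityZ3.Theorems

end
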